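import Mathlib
import Summits.MatrixMultiplication.MatrixMultiplication.Theses.GLnSeparatingDesigns
import Literature.NumberTheory.DiophantineGeometry.GLPolynomialRepSemisimpleProofs
import Summits.MatrixMultiplication.MatrixMultiplication.Theorems.GLnSeparatingDesignsBorderHalfDimensionDesignsStubSplitOuterTimesInvariants
import Summits.MatrixMultiplication.MatrixMultiplication.Theorems.GLnSeparatingDesignsBorderHalfDimensionDesignsStubSplitCardLeFinrankSpan
import Summits.MatrixMultiplication.MatrixMultiplication.Theorems.GLnSeparatingDesignsBorderHalfDimensionDesignsStubSplitFinrankSpanLe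

/-!
# The split-design barrier, volume form (E2 step (iii), line `Ideate5Sketch`)

Stub `stub_split_volume_le` (crux `BorderHalfDimensionDesigns`, stmt-MatrixMultiplication-18360, route
`GLnSeparatingDesigns`): the strategist's **split-design barrier** (STRATEGY-CENSUS.md §Negation; paper proof
(i)–(iii)) as a tree theorem.  Outer sets in subgroups `H₁ ∋ x`, `H₂ ∋ z⁻¹` with `η`-approximate target readers of
degree `≤ s` (`η·|X||Z| < 1`), one middle test `p₀` of degree `≤ s`, left-`(H₁,χ₁)`- and right-`(H₂,χ₂)`-semi-
invariant on `GL_n(ℂ)`, with nonsingular Gram matrix on `Y`, force `|X|·|Y|·|Z| ≤ s^(n(n−1)/2) · C(2s+n², n²)`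
(`n ≥ 3`, `s ≥ 2`).  Composition of the landed steps with `g` a basis of the bi-semi-invariants of degree `≤ s`:
(i) `stub_split_outer_times_invariants_le` (`|X||Z|·b ≤ C(2s+n²,n²)`), (ii-a) `stub_split_card_le_finrank_span`
(`|Y| ≤ dim span{R_g p₀}`), (ii-b) `stub_split_finrank_span_le` (`dim span{R_g p₀} ≤ s^(C(n,2))·b`).
Consequence (landed separately as `stub_not_split_of_splitLaw`): the split form of the crux is false already for
`ε < 1/6`; every design mechanism in print or on file for this crux (BCGPU 2024 §2.4 / Lemma 2.11) is split.
-/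

set_option linter.dupNamespace false

noncomputable section

open scoped BigOperators Matrix
open Literature.NumberTheory.DiophantineGeometry MvPolynomial

namespace Summit.MatrixMultiplication.MatrixMultiplication.Theorems.BorderHalfDimensionDesigns

/-- **The split-design barrier (volume form).**  See the module docstring. [folklore] -/
theorem stub_split_volume_le {n s : ℕ} {η : ℝ} (hn : 3 ≤ n) (hs : 2 ≤ s)
    (H₁ H₂ : Subgroup (Matrix.GeneralLinearGroup (Fin n) ℂ)) (χ₁ χ₂ : Matrix.GeneralLinearGroup (Fin n) ℂ → ℂ)
    (X Y Z : Finset (Matrix.GeneralLinearGroup (Fin n) ℂ))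
    (hX : ∀ x ∈ X, x ∈ H₁) (hZ : ∀ z ∈ Z, z⁻¹ ∈ H₂)
    (hread : ∀ x₀ ∈ X, ∀ z₀ ∈ Z, ∃ r : MvPolynomial (Fin n × Fin n) ℂ, r.totalDegree ≤ s ∧
      ∀ x ∈ X, ∀ z ∈ Z,
        ((x = x₀ ∧ z = z₀) → ‖MvPolynomial.eval (fun ij : Fin n × Fin n =>
          ((x * z⁻¹ : Matrix.GeneralLinearGroup (Fin n) ℂ) : Matrix (Fin n) (Fin n) ℂ) ij.1 ij.2) r - 1‖ ≤ η) ∧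
        (¬ (x = x₀ ∧ z = z₀) → ‖MvPolynomial.eval (fun ij : Fin n × Fin n =>
          ((x * z⁻¹ : Matrix.GeneralLinearGroup (Fin n) ℂ) : Matrix (Fin n) (Fin n) ℂ) ij.1 ij.2) r‖ ≤ η))
    (hη : η * (X.card * Z.card) < 1)
    (p₀ : MvPolynomial (Fin n × Fin n) ℂ) (hp₀ : p₀.totalDegree ≤ s)
    (hleft : ∀ h ∈ H₁, ∀ w : Matrix.GeneralLinearGroup (Fin n) ℂ,
      MvPolynomial.eval (fun ij : Fin n × Fin n =>
        ((h * w : Matrix.GeneralLinearGroup (Fin n) ℂ) : Matrix (Fin n) (Fin n) ℂ) ij.1 ij.2) p₀ =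
      χ₁ h * MvPolynomial.eval (fun ij : Fin n × Fin n => (w : Matrix (Fin n) (Fin n) ℂ) ij.1 ij.2) p₀)
    (hright : ∀ h ∈ H₂, ∀ w : Matrix.GeneralLinearGroup (Fin n) ℂ,
      MvPolynomial.eval (fun ij : Fin n × Fin n =>
        ((w * h : Matrix.GeneralLinearGroup (Fin n) ℂ) : Matrix (Fin n) (Fin n) ℂ) ij.1 ij.2) p₀ =
      χ₂ h * MvPolynomial.eval (fun ij : Fin n × Fin n => (w : Matrix (Fin n) (Fin n) ℂ) ij.1 ij.2) p₀)
    (hGram : (Matrix.of fun y y' : ↥Y => MvPolynomial.eval (fun ij : Fin n × Fin n =>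
      ((y.1⁻¹ * y'.1 : Matrix.GeneralLinearGroup (Fin n) ℂ) : Matrix (Fin n) (Fin n) ℂ) ij.1 ij.2) p₀).det ≠ 0) :
    X.card * Y.card * Z.card ≤ s ^ (n * (n - 1) / 2) * (2 * s + n ^ 2).choose (n ^ 2) := by
  classical
  -- the bi-semi-invariant polynomials of degree `≤ s`, a finite-dimensional subspace
  let SI : Submodule ℂ (MvPolynomial (Fin n × Fin n) ℂ) :=
    { carrier := {p | p.totalDegree ≤ s ∧
        (∀ h ∈ H₁, ∀ w : Matrix.GeneralLinearGroup (Fin n) ℂ,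
          MvPolynomial.eval (fun ij : Fin n × Fin n =>
            ((h * w : Matrix.GeneralLinearGroup (Fin n) ℂ) : Matrix (Fin n) (Fin n) ℂ) ij.1 ij.2) p =
          χ₁ h * MvPolynomial.eval (fun ij : Fin n × Fin n => (w : Matrix (Fin n) (Fin n) ℂ) ij.1 ij.2) p) ∧
        (∀ h ∈ H₂, ∀ w : Matrix.GeneralLinearGroup (Fin n) ℂ,
          MvPolynomial.eval (fun ij : Fin n × Fin n =>
            ((w * h : Matrix.GeneralLinearGroup (Fin n) ℂ) : Matrix (Fin n) (Fin n) ℂ) ij.1 ij.2) p =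
          χ₂ h * MvPolynomial.eval (fun ij : Fin n × Fin n => (w : Matrix (Fin n) (Fin n) ℂ) ij.1 ij.2) p)}
      add_mem' := by
        rintro x y ⟨hx0, hx1, hx2⟩ ⟨hy0, hy1, hy2⟩
        refine ⟨(totalDegree_add x y).trans (max_le hx0 hy0), fun h hh w => ?_, fun h hh w => ?_⟩
        · rw [map_add, map_add, hx1 h hh w, hy1 h hh w, mul_add]
        · rw [map_add, map_add, hx2 h hh w, hy2 h hh w, mul_add]
      zero_mem' := ⟨by simp, fun h _ w => by simp, fun h _ w => by simp⟩
      smul_mem' := by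
        rintro c x ⟨hx0, hx1, hx2⟩
        refine ⟨?_, fun h hh w => ?_, fun h hh w => ?_⟩
        · exact (totalDegree_smul_le c x).trans hx0
        · rw [smul_eval, smul_eval, hx1 h hh w]; ring
        · rw [smul_eval, smul_eval, hx2 h hh w]; ring }
  have hSIle : SI ≤ restrictTotalDegree (Fin n × Fin n) ℂ s := fun p hp =>
    (mem_restrictTotalDegree _ _ p).2 hp.1
  haveI : FiniteDimensional ℂ SI := Submodule.finiteDimensional_of_le hSIle
  -- a basis of `SI`, as a family of polynomials
  set b := Module.finrank ℂ SI with hb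
  let B := Module.finBasis ℂ SI
  let g : Fin b → MvPolynomial (Fin n × Fin n) ℂ := fun j => (B j : MvPolynomial (Fin n × Fin n) ℂ)
  have hg : LinearIndependent ℂ g := B.linearIndependent.map' SI.subtype (Submodule.ker_subtype SI)
  have hgmem : ∀ j, g j ∈ SI := fun j => (B j).2
  have hspan : ∀ p : MvPolynomial (Fin n × Fin n) ℂ, p.totalDegree ≤ s →
      (∀ h ∈ H₁, ∀ w : Matrix.GeneralLinearGroup (Fin n) ℂ,
        MvPolynomial.eval (fun ij : Fin n × Fin n =>
          ((h * w : Matrix.GeneralLinearGroup (Fin n) ℂ) : Matrix (Fin n) (Fin n) ℂ) ij.1 ij.2) p =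
        χ₁ h * MvPolynomial.eval (fun ij : Fin n × Fin n => (w : Matrix (Fin n) (Fin n) ℂ) ij.1 ij.2) p) →
      (∀ h ∈ H₂, ∀ w : Matrix.GeneralLinearGroup (Fin n) ℂ,
        MvPolynomial.eval (fun ij : Fin n × Fin n =>
          ((w * h : Matrix.GeneralLinearGroup (Fin n) ℂ) : Matrix (Fin n) (Fin n) ℂ) ij.1 ij.2) p =
        χ₂ h * MvPolynomial.eval (fun ij : Fin n × Fin n => (w : Matrix (Fin n) (Fin n) ℂ) ij.1 ij.2) p) →
      p ∈ Submodule.span ℂ (Set.range g) := by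
    intro p hp0 hp1 hp2
    have hpSI : (⟨p, hp0, hp1, hp2⟩ : SI) ∈ Submodule.span ℂ (Set.range B) := B.mem_span _
    have := Submodule.mem_map_of_mem (f := SI.subtype) hpSI
    rw [Submodule.map_span, ← Set.range_comp] at this
    exact this
  -- the three counts
  have hi : X.card * Z.card * b ≤ (2 * s + n ^ 2).choose (n ^ 2) :=
    stub_split_outer_times_invariants_le H₁ H₂ χ₁ χ₂ X Z hX hZ hread hη g hg
      (fun j => (hgmem j).1) (fun j => (hgmem j).2.1) (fun j => (hgmem j).2.2)
  have hiia := stub_split_card_le_finrank_span Y p₀ hGram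
  have hiib := stub_split_finrank_span_le hn hs H₁ H₂ χ₁ χ₂ g hspan p₀ hp₀ hleft hright
  have hY : Y.card ≤ s ^ (n * (n - 1) / 2) * b := hiia.trans hiib
  have h1 : X.card * Y.card * Z.card ≤ s ^ (n * (n - 1) / 2) * (X.card * Z.card * b) :=
    calc X.card * Y.card * Z.card = Y.card * (X.card * Z.card) := by ring
      _ ≤ s ^ (n * (n - 1) / 2) * b * (X.card * Z.card) := Nat.mul_le_mul_right _ hY
      _ = s ^ (n * (n - 1) / 2) * (X.card * Z.card * b) := by ring
  exact h1.trans (Nat.mul_le_mul_left _ hi)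

end Summit.MatrixMultiplication.MatrixMultiplication.Theorems.BorderHalfDimensionDesigns
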